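import Literature.NumberTheory.EllipticCurves.BSDQuadraticDescentShaOddPartProofs
import Literature.NumberTheory.EllipticCurves.BSDQuadraticDescentPeriodEliminationProofs
import Literature.NumberTheory.EllipticCurves.ComplexMultiplicationBurungaleFlachPrimaryProofs
import Literature.NumberTheory.EllipticCurves.TamagawaFiniteIndexProofs
import Mathlib.Data.Nat.Factorization.Basic
import HarnessLib

/-!
# The odd part of the Mordell–Weil torsion under quadratic base change

`Proofs` file (theorems only, no definitions, no named facts) in topic
`NumberTheory/EllipticCurves`, supporting the named fact
`WeierstrassCurve.bsdRHS_baseChange_quadratic` of `BSDQuadraticDescent` (Milne, Invent. Math. 17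
(1972), §1 Thm. 1 / Dokchitser–Dokchitser, Ann. of Math. 172 (2010), §2.1, proof of Thm. 8: the
BSD quotient of `E_K/K` is the product of those of `E/ℚ` and `E^{(d_K)}/ℚ`).  By
`WeierstrassCurve.bsdQuotient_baseChange_quadratic_eq_iff` (`BSDQuadraticDescentPeriodEliminationProofs`)
that identity is an identity of rationals between `#Ш`, Tamagawa products and the orders of the
finite Mordell–Weil groups `#W'(K)`, `#W(ℚ)`, `#Wd(ℚ)`; its odd-primary `Ш`-part is
`WeierstrassCurve.card_primaryComponent_sha_baseChange_quadratic_of_odd`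
(`BSDQuadraticDescentShaOddPartProofs`).  This file proves the companion statement for the
Mordell–Weil groups — the **eigenspace decomposition of `E(K)` under `Gal(K/F)` away from `2`**
(Silverman, *AEC*, X.2 Prop. 2.4, Exercise 10.22 (c) — the trace sequence
`0 → E_D(K) → E(L) → E(K) → V → 0` with `E(K)/2E(K) ↠ V`, which is exact on `p`-primary parts for
odd `p` — and its rank corollary Exercise 10.16; the argument of the tree's rank identity
`WeierstrassCurve.lift_rank_point_baseChange_quadraticTwist_one`, file `QuadraticTwistRank`, read
on `p`-primary components instead of ranks):

for a field `F` with `2 ≠ 0`, a quadratic extension `K = F(θ)`, `θ² = c ∈ F`, `θ ∉ F`, a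
Weierstrass curve `W/F` with completed-square model `V = W^{(1)}`, the inclusion
`ι : V(F) → V(K)` and the twisting map `τ : W^{(c)}(F) → V(K)`
(`WeierstrassCurve.QuadraticDescent.incl/twistMap`) and the conjugation `σ` of `K/F`:

* `QuadraticDescent.mem_range_incl_of_conjMap_eq`, `mem_range_twistMap_of_conjMap_eq_neg`:
  `σ`-fixed points come from `V(F)`, `σ`-anti-fixed points from the twist;
* `QuadraticDescent.two_nsmul_eq_zero_of_incl_add_twistMap_eq_zero`: if `ι Q + τ R = O` then
  `2Q = O` and `2R = O` (`im ι ∩ im τ ⊆ V(K)[2]`);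
* `QuadraticDescent.add_conjMap_mem_range_incl`, `sub_conjMap_mem_range_twistMap`:
  `P + σP ∈ im ι`, `P - σP ∈ im τ` (so `2 V(K) ⊆ im ι + im τ`);
* `QuadraticDescent.exists_addEquiv_primaryComponent_prod`: hence for every ODD prime `p` the map
  `(Q, R) ↦ ι Q + τ R` is an isomorphism
  `V(F)[p^∞] × W^{(c)}(F)[p^∞] ≅ V(K)[p^∞]` of `p`-primary components
  (kernel and cokernel killed by `2`: `Literature.NumberTheory.EllipticCurves.bijective_of_two_pow_nsmul_ker_of_two_pow_nsmul_coker`);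
* `card_primaryComponent_point_baseChange_quadratic_of_odd'` (any models `Wd ≅ W^{(c)}` over `F`,
  `W' ≅ W_K` over `K`) and `card_primaryComponent_point_baseChange_quadratic_of_odd` (`Wd` a model
  of `W^{(d)}` for any `d = c q²`; over `ℚ`, `d = d_K` by `NumberField.exists_discr_eq_mul_sq`):
  `#W'(K)[p^∞] = #W(F)[p^∞] · #Wd(F)[p^∞]` for odd `p` (`Nat.card`, no finiteness assumed).

With the two files quoted above: in the identity of rationals equivalent to
`bsdRHS_baseChange_quadratic`, the `Ш`-orders and the Mordell–Weil orders balance `ℓ`-adically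
at every odd prime `ℓ`, so that what remains is its `2`-adic valuation together with the
odd part of `|N_{K/ℚ}(u')| ∏_w c_w(W') = |u_d| ∏_p c_p(W) c_p(Wd)` (local indices of the isogeny
`E × E^{(D)} → Res_{K/ℚ} E_K`, Milne *ADT* I.7.3) — not treated here.

## Part II (appended): the odd part of (R1) in valuations, and what remains

By `WeierstrassCurve.bsdQuotient_baseChange_quadratic_eq_iff` (`BSDQuadraticDescentPeriodEliminationProofs`)
the named fact is, for each datum `(W, K, Wd = C_d • W^{(d_K)}, W' = C' • W_K)` with `W'(K)` and
`Ш(W'/K)` finite, the identity of positive rationals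

  `(R1)  |N_{K/ℚ}(u')| · #Ш(W') · ∏_w c_w(W') · #W(ℚ)² · #Wd(ℚ)²
            = n_W · |u_d| · #Ш(W) · #Ш(Wd) · ∏_p c_p(W) · ∏_p c_p(Wd) · #W'(K)²`.

A positive rational is determined by its `p`-adic valuations
(`Literature.NumberTheory.EllipticCurves.rat_eq_iff_forall_prime_padicValRat_eq`), and at an ODD
prime `p` the `Ш`-orders and the Mordell–Weil orders in (R1) balance:

* `WeierstrassCurve.padicValNat_natCard_point_baseChange_quadratic_of_odd` (any `F` with `2 ≠ 0`,
  models of `W^{(c q²)}` and of `W_K`, `W'(K)` finite): `v_p(#W'(K)) = v_p(#W(F)) + v_p(#Wd(F))`,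
  from Part I and `#A[p^∞] = p^{v_p(#A)}`
  (`Literature.NumberTheory.EllipticCurves.natCard_primaryComponent_eq_pow_padicValNat`, Lagrange/Cauchy via the tree's
  `exists_natCard_eq_card_primaryComponent_mul`);
* `WeierstrassCurve.padicValNat_shaOrder_baseChange_quadratic_of_odd` (over `ℚ`, `Wd` a model of
  `W^{(d_K)}`, `W'(K)` and `Ш(W')` finite): `v_p(#Ш(W')) = v_p(#Ш(W)) + v_p(#Ш(Wd))`, from
  `WeierstrassCurve.card_primaryComponent_sha_baseChange_quadratic_of_odd`
  (`BSDQuadraticDescentShaOddPartProofs`; Dokchitser–Dokchitser, Lemma 4.14);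

so that (R1) is equivalent to the conjunction of its `2`-adic valuation and, for every odd `p`,
of `v_p(|N_{K/ℚ}(u')| · ∏_w c_w(W')) = v_p(|u_d| · ∏_p c_p(W) · ∏_p c_p(Wd))`
(`WeierstrassCurve.card_identity_iff_padicValRat`), and the named fact follows from these two
statements quantified over the data (`WeierstrassCurve.bsdRHS_baseChange_quadratic_of_padicValRat`).
In Milne's proof both are read off from the local indices `#coker/#ker` of the isogeny
`E × E^{(D)} → Res_{K/ℚ} E_K` on `ℚ_v`-points (Tamagawa numbers, the scalars `u'`, `u_d`, the
`2`-group structure of kernel and cokernel) and, for `p = 2`, from the Cassels–Tate pairing and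
Poitou–Tate duality (*ADT* I.7.3, (7.3.1)); none of this is used or asserted here.  (Part II lives
in this file rather than in a sibling so that its import closure consists of built modules only.)

## References

* J. H. Silverman, *The Arithmetic of Elliptic Curves*, 2nd ed., GTM 106 (2009), X.2 Prop. 2.4,
  X.5 Cor. 5.4, Exercise 10.22 (c) (trace map `T_{L/K}`: kernel `E_D(K)`, cokernel a quotient of
  `E(K)/2E(K)`), Exercise 10.16 (the rank form). [SilvermanAEC2009]
* J. S. Milne, Invent. Math. 17 (1972), §1 Thm. 1, §2. [Milne1972ArithmeticAV]
* T. Dokchitser, V. Dokchitser, Ann. of Math. 172 (2010), §2.1, proof of Thm. 8; Lemma 4.14.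
  [DokchitserDokchitserAnnals2010]
* J. S. Milne, *Arithmetic Duality Theorems*, 2nd ed. (2006), Thm. I.7.3. [MilneADT2006]

## Design

Theorems only (D-0026).  General statements over a field `F` with `[NeZero (2 : F)]` (the
setting and the `open scoped Classical` decidability of `QuadraticTwistRank`, whose point groups
over `ℚ` are obtained by instantiating the general statements at `F = ℚ`, see the design note
there); the isomorphism of `p`-primary components is asserted to exist (`∃ e, …` with its values
specified) rather than defined, to keep the file free of definitions.  Part II: valuations of natural
numbers are `padicValNat`, of the rational sides of (R1) `padicValRat`; statements over `ℚ` mention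
the point groups only through `Nat.card` of their carriers, the group-theoretic input being the
general-field theorem of Part I instantiated at `F = ℚ` inside the proofs.
-/

noncomputable section

open scoped Classical

open Module

universe u v

namespace Literature.NumberTheory.EllipticCurves

/-- An additive isomorphism preserves the orders of the `p`-primary components
(`p^k • g = 0 ↔ p^k • e g = 0`). [folklore] -/
theorem natCard_primaryComponent_congr {G H : Type*} [AddCommGroup G] [AddCommGroup H]
    (e : G ≃+ H) (p : ℕ) :
    Nat.card (AddCommGroup.primaryComponent G p) = Nat.card (AddCommGroup.primaryComponent H p) := by
  refine Nat.card_congr (e.toEquiv.subtypeEquiv fun g => ?_)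
  simp only [AddCommGroup.mem_primaryComponent]
  refine exists_congr fun k => ?_
  rw [AddEquiv.toEquiv_eq_coe, EquivLike.coe_coe, ← map_nsmul, e.map_eq_zero_iff]

end Literature.NumberTheory.EllipticCurves

namespace WeierstrassCurve

open Literature.NumberTheory.EllipticCurves Literature.NumberTheory.QuadraticFields

section General

variable {F : Type u} {K : Type v} [Field F] [Field K] [Algebra F K] [NeZero (2 : F)]
  (W : WeierstrassCurve F) (h2 : finrank F K = 2) {θ : K} {c : F}
  (hθ : θ ∉ Set.range (algebraMap F K)) (hc : θ ^ 2 = algebraMap F K c)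

namespace QuadraticDescent

/-! ### Eigenvectors of the conjugation -/

/-- **`σ`-fixed points of `V(K)` come from `V(F)`** (`V = W^{(1)}`, `σ` the conjugation of
`K = F(θ)`): both coordinates are fixed by `σ`, hence lie in `F`
(`Quadratic.exists_eq_algebraMap_of_conj_eq`). Silverman, *AEC*, Exercises 10.22 (c) / 10.16.
[cite: SilvermanAEC2009, Exercise 10.22 (c) and Exercise 10.16] -/
theorem mem_range_incl_of_conjMap_eq (P : ((W.quadraticTwist 1).baseChange K).toAffine.Point)
    (hP : conjMap (W.quadraticTwist 1) (Quadratic.conj h2 hθ hc) P = P) :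
    P ∈ (incl K (W.quadraticTwist 1)).range := by
  rcases P with _ | ⟨x, y, h⟩
  · exact AddMonoidHom.mem_range.mpr ⟨0, by rw [map_zero]; rfl⟩
  · rw [Affine.Point.map_some, Affine.Point.some.injEq] at hP
    obtain ⟨a, ha⟩ := Quadratic.exists_eq_algebraMap_of_conj_eq h2 hθ hc hP.1
    obtain ⟨b, hb⟩ := Quadratic.exists_eq_algebraMap_of_conj_eq h2 hθ hc hP.2
    obtain ⟨Q, hQ⟩ := exists_incl_eq (K := K) (W.quadraticTwist 1) h ha.symm hb.symm
    exact AddMonoidHom.mem_range.mpr ⟨Q, hQ⟩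

/-- **`σ`-anti-fixed points of `V(K)` come from the twist**: if `σP = -P` then `P = (a, bθ)`
with `a, b ∈ F` (`Quadratic.exists_eq_mul_of_conj_eq_neg`), which is `τ(ca, c²b)`
(`exists_twistMap_eq`). Silverman, *AEC*, X.2, proof of Prop. 2.4, and Exercise 10.16.
[cite: SilvermanAEC2009, Exercise 10.22 (c) and Exercise 10.16] -/
theorem mem_range_twistMap_of_conjMap_eq_neg
    (P : ((W.quadraticTwist 1).baseChange K).toAffine.Point)
    (hP : conjMap (W.quadraticTwist 1) (Quadratic.conj h2 hθ hc) P = -P) :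
    P ∈ (twistMap W hθ hc).range := by
  rcases P with _ | ⟨x, y, h⟩
  · exact AddMonoidHom.mem_range.mpr ⟨0, by rw [map_zero]; rfl⟩
  · rw [Affine.Point.map_some, Affine.Point.neg_some, Affine.Point.some.injEq,
      negY_quadraticTwist_one_baseChange] at hP
    obtain ⟨a, ha⟩ := Quadratic.exists_eq_algebraMap_of_conj_eq h2 hθ hc hP.1
    obtain ⟨b, hb⟩ := Quadratic.exists_eq_mul_of_conj_eq_neg h2 hθ hc hP.2
    obtain ⟨R, hR⟩ := exists_twistMap_eq W hθ hc h ha.symm hb.symm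
    exact AddMonoidHom.mem_range.mpr ⟨R, hR⟩

include h2 in
/-- **`im ι ∩ im τ ⊆ V(K)[2]`, kernel form**: if `ι Q + τ R = O` then `2Q = O` and `2R = O`
(apply `σ`: it fixes `ι Q` and negates `τ R = -ι Q`, so `ι Q = -ι Q`; `ι`, `τ` are injective).
Silverman, *AEC*, Exercises 10.22 (c) / 10.16.
[cite: SilvermanAEC2009, Exercise 10.22 (c) and Exercise 10.16] -/
theorem two_nsmul_eq_zero_of_incl_add_twistMap_eq_zero (Q : (W.quadraticTwist 1).toAffine.Point)
    (R : (W.quadraticTwist c).toAffine.Point)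
    (h : incl K (W.quadraticTwist 1) Q + twistMap W hθ hc R = 0) : 2 • Q = 0 ∧ 2 • R = 0 := by
  have hσθ : Quadratic.conj h2 hθ hc θ = -θ := Quadratic.conj_gen h2 hθ hc
  have hιQ : incl K (W.quadraticTwist 1) Q = -(twistMap W hθ hc R) := eq_neg_of_add_eq_zero_left h
  have h1 : conjMap (W.quadraticTwist 1) (Quadratic.conj h2 hθ hc) (incl K (W.quadraticTwist 1) Q) =
      incl K (W.quadraticTwist 1) Q := conjMap_incl _ _ Q
  have h1' : conjMap (W.quadraticTwist 1) (Quadratic.conj h2 hθ hc) (incl K (W.quadraticTwist 1) Q) =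
      -(incl K (W.quadraticTwist 1) Q) := by
    rw [hιQ, map_neg, conjMap_twistMap W hθ hc hσθ R]
  have h2Q : (2 : ℕ) • incl K (W.quadraticTwist 1) Q = 0 := by
    rw [two_nsmul]
    nth_rewrite 1 [← h1]
    rw [h1', neg_add_cancel]
  refine ⟨incl_injective (K := K) _ (by rw [map_nsmul, map_zero, h2Q]),
    twistMap_injective W hθ hc ?_⟩
  have h2sum : (2 : ℕ) • (incl K (W.quadraticTwist 1) Q + twistMap W hθ hc R) = 0 := by
    rw [h, nsmul_zero]
  rw [nsmul_add, h2Q, zero_add] at h2sum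
  rw [map_nsmul, map_zero, h2sum]

/-- `P + σP` comes from `V(F)` (it is `σ`-fixed, `σ² = 1`). Silverman, *AEC*, Exercises 10.22 (c) / 10.16.
[cite: SilvermanAEC2009, Exercise 10.22 (c) and Exercise 10.16] -/
theorem add_conjMap_mem_range_incl (P : ((W.quadraticTwist 1).baseChange K).toAffine.Point) :
    P + conjMap (W.quadraticTwist 1) (Quadratic.conj h2 hθ hc) P ∈
      (incl K (W.quadraticTwist 1)).range :=
  mem_range_incl_of_conjMap_eq W h2 hθ hc _ (by
    rw [map_add, conjMap_conjMap _ (Quadratic.conj_conj h2 hθ hc), add_comm])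

/-- `P - σP` comes from the twist (it is `σ`-anti-fixed). Silverman, *AEC*, Exercises 10.22 (c) / 10.16.
[cite: SilvermanAEC2009, Exercise 10.22 (c) and Exercise 10.16] -/
theorem sub_conjMap_mem_range_twistMap (P : ((W.quadraticTwist 1).baseChange K).toAffine.Point) :
    P - conjMap (W.quadraticTwist 1) (Quadratic.conj h2 hθ hc) P ∈ (twistMap W hθ hc).range :=
  mem_range_twistMap_of_conjMap_eq_neg W h2 hθ hc _ (by
    rw [map_sub, conjMap_conjMap _ (Quadratic.conj_conj h2 hθ hc), neg_sub])

/-! ### The `p`-primary components for odd `p` -/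

include h2 in
/-- **`V(F)[p^∞] × W^{(c)}(F)[p^∞] ≅ V(K)[p^∞]` for odd `p`**, via `(Q, R) ↦ ι Q + τ R`
(`V = W^{(1)}`, `K = F(θ)`, `θ² = c`): the map is well defined on `p`-primary components, its
kernel is killed by `2` (`two_nsmul_eq_zero_of_incl_add_twistMap_eq_zero`) and `2P = (P + σP) +
(P - σP)` lies in its image with `p`-primary preimages (`ι`, `τ` injective), so at an odd prime
it is bijective (`bijective_of_two_pow_nsmul_ker_of_two_pow_nsmul_coker`). The eigenspace
decomposition of Silverman, *AEC*, Exercises 10.22 (c) / 10.16 / Dokchitser–Dokchitser 2010, proof of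
Lemma 4.14 (`H⁰` terms), away from `2`.
[cite: SilvermanAEC2009, Exercise 10.22 (c) and Exercise 10.16] -/
theorem exists_addEquiv_primaryComponent_prod (p : ℕ) [Fact p.Prime] (hp : p ≠ 2) :
    ∃ e : (AddCommGroup.primaryComponent (W.quadraticTwist 1).toAffine.Point p ×
        AddCommGroup.primaryComponent (W.quadraticTwist c).toAffine.Point p) ≃+
        AddCommGroup.primaryComponent ((W.quadraticTwist 1).baseChange K).toAffine.Point p,
      ∀ x, (e x : ((W.quadraticTwist 1).baseChange K).toAffine.Point) =
        incl K (W.quadraticTwist 1) (x.1 : (W.quadraticTwist 1).toAffine.Point) +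
          twistMap W hθ hc (x.2 : (W.quadraticTwist c).toAffine.Point) := by
  set A := AddCommGroup.primaryComponent (W.quadraticTwist 1).toAffine.Point p with hA_def
  set B := AddCommGroup.primaryComponent (W.quadraticTwist c).toAffine.Point p with hB_def
  set C := AddCommGroup.primaryComponent ((W.quadraticTwist 1).baseChange K).toAffine.Point p
    with hC_def
  set Φ : (W.quadraticTwist 1).toAffine.Point × (W.quadraticTwist c).toAffine.Point →+
      ((W.quadraticTwist 1).baseChange K).toAffine.Point :=
    (incl K (W.quadraticTwist 1)).coprod (twistMap W hθ hc) with hΦ_def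
  -- `Φ` maps `p`-primary pairs to `p`-primary points
  have hmem : ∀ x : A × B, Φ ((A.subtype.prodMap B.subtype) x) ∈ C := by
    rintro ⟨⟨Q, hQ⟩, ⟨R, hR⟩⟩
    obtain ⟨kQ, hkQ⟩ := (AddCommGroup.mem_primaryComponent).mp hQ
    obtain ⟨kR, hkR⟩ := (AddCommGroup.mem_primaryComponent).mp hR
    have hQ' : p ^ (kQ + kR) • Q = 0 := by rw [pow_add, mul_nsmul, hkQ, nsmul_zero]
    have hR' : p ^ (kQ + kR) • R = 0 := by rw [pow_add, mul_nsmul', hkR, nsmul_zero]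
    refine (AddCommGroup.mem_primaryComponent).mpr ⟨kQ + kR, ?_⟩
    change p ^ (kQ + kR) • (incl K (W.quadraticTwist 1) Q + twistMap W hθ hc R) = 0
    rw [nsmul_add, ← map_nsmul, ← map_nsmul, hQ', hR', map_zero, map_zero, add_zero]
  set f : A × B →+ C := (Φ.comp (A.subtype.prodMap B.subtype)).codRestrict C hmem with hf_def
  have hf : ∀ x : A × B, ((f x : C) : ((W.quadraticTwist 1).baseChange K).toAffine.Point) =
      incl K (W.quadraticTwist 1) (x.1 : (W.quadraticTwist 1).toAffine.Point) +
        twistMap W hθ hc (x.2 : (W.quadraticTwist c).toAffine.Point) := fun x => rfl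
  have hodd : Odd p := (Fact.out : p.Prime).odd_of_ne_two hp
  -- all groups in sight are `p`-primary
  have hA : ∀ x : A × B, ∃ k : ℕ, (p ^ k) • x = 0 := by
    rintro ⟨⟨Q, hQ⟩, ⟨R, hR⟩⟩
    obtain ⟨kQ, hkQ⟩ := (AddCommGroup.mem_primaryComponent).mp hQ
    obtain ⟨kR, hkR⟩ := (AddCommGroup.mem_primaryComponent).mp hR
    have hQ' : p ^ (kQ + kR) • Q = 0 := by rw [pow_add, mul_nsmul, hkQ, nsmul_zero]
    have hR' : p ^ (kQ + kR) • R = 0 := by rw [pow_add, mul_nsmul', hkR, nsmul_zero]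
    refine ⟨kQ + kR, Prod.ext (Subtype.ext ?_) (Subtype.ext ?_)⟩
    · simpa only [Prod.smul_fst, AddSubgroupClass.coe_nsmul, Prod.fst_zero, ZeroMemClass.coe_zero]
        using hQ'
    · simpa only [Prod.smul_snd, AddSubgroupClass.coe_nsmul, Prod.snd_zero, ZeroMemClass.coe_zero]
        using hR'
  have hB : ∀ y : C, ∃ k : ℕ, (p ^ k) • y = 0 := by
    rintro ⟨P, hP⟩
    obtain ⟨k, hk⟩ := (AddCommGroup.mem_primaryComponent).mp hP
    exact ⟨k, Subtype.ext (by simp only [AddSubgroupClass.coe_nsmul, ZeroMemClass.coe_zero, hk])⟩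
  -- kernel killed by `2`
  have hker : ∀ x : A × B, f x = 0 → (2 ^ 1) • x = 0 := by
    rintro ⟨⟨Q, hQ⟩, ⟨R, hR⟩⟩ hx
    have hx' : incl K (W.quadraticTwist 1) Q + twistMap W hθ hc R = 0 := by
      have := congrArg (fun z : C => (z : ((W.quadraticTwist 1).baseChange K).toAffine.Point)) hx
      simpa only [hf, ZeroMemClass.coe_zero] using this
    obtain ⟨h2Q, h2R⟩ := two_nsmul_eq_zero_of_incl_add_twistMap_eq_zero W h2 hθ hc Q R hx'
    rw [pow_one]
    exact Prod.ext (Subtype.ext (by simpa using h2Q)) (Subtype.ext (by simpa using h2R))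
  -- cokernel killed by `2`: `2P = (P + σP) + (P - σP)` with `p`-primary preimages
  have hcoker : ∀ y : C, (2 ^ 1) • y ∈ f.range := by
    rintro ⟨P, hP⟩
    obtain ⟨k, hk⟩ := (AddCommGroup.mem_primaryComponent).mp hP
    set σ := Quadratic.conj h2 hθ hc with hσ_def
    obtain ⟨Q, hQ⟩ := AddMonoidHom.mem_range.mp (add_conjMap_mem_range_incl W h2 hθ hc P)
    obtain ⟨R, hR⟩ := AddMonoidHom.mem_range.mp (sub_conjMap_mem_range_twistMap W h2 hθ hc P)
    have hQA : Q ∈ A := by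
      refine (AddCommGroup.mem_primaryComponent).mpr ⟨k, incl_injective (K := K) _ ?_⟩
      rw [map_nsmul, map_zero, hQ, nsmul_add, ← map_nsmul, hk, map_zero, add_zero]
    have hRB : R ∈ B := by
      refine (AddCommGroup.mem_primaryComponent).mpr ⟨k, twistMap_injective W hθ hc ?_⟩
      rw [map_nsmul, map_zero, hR, nsmul_sub, ← map_nsmul, hk, map_zero, sub_zero]
    refine AddMonoidHom.mem_range.mpr ⟨(⟨Q, hQA⟩, ⟨R, hRB⟩), Subtype.ext ?_⟩
    rw [hf]
    simp only [AddSubgroupClass.coe_nsmul, pow_one]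
    rw [hQ, hR, two_nsmul]
    abel
  have hbij := bijective_of_two_pow_nsmul_ker_of_two_pow_nsmul_coker hodd f hA hB hker hcoker
  exact ⟨AddEquiv.ofBijective f hbij, fun x => hf x⟩

end QuadraticDescent

open QuadraticDescent

include h2 hθ hc in
/-- **`#V(K)[p^∞] = #V(F)[p^∞] · #W^{(c)}(F)[p^∞]` for odd `p`** (`V = W^{(1)}` the
completed-square model, `K = F(θ)`, `θ² = c`; `Nat.card`, so `0 = 0` if a group is infinite).
Silverman, *AEC*, Exercises 10.22 (c) / 10.16, on `p`-primary components.
[cite: SilvermanAEC2009, Exercise 10.22 (c) and Exercise 10.16] -/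
theorem card_primaryComponent_point_quadraticTwist_one_baseChange (p : ℕ) [Fact p.Prime]
    (hp : p ≠ 2) :
    Nat.card (AddCommGroup.primaryComponent ((W.quadraticTwist 1).baseChange K).toAffine.Point p) =
      Nat.card (AddCommGroup.primaryComponent (W.quadraticTwist 1).toAffine.Point p) *
        Nat.card (AddCommGroup.primaryComponent (W.quadraticTwist c).toAffine.Point p) := by
  obtain ⟨e, -⟩ := exists_addEquiv_primaryComponent_prod W h2 hθ hc p hp
  rw [← Nat.card_congr e.toEquiv, Nat.card_prod]

include h2 hθ hc in
/-- **The odd part of the Mordell–Weil group under quadratic base change, any models**: for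
`K = F(θ)`, `θ² = c`, `2 ≠ 0` in `F`, an `F`-model `Wd ≅ W^{(c)}` and a `K`-model `W' ≅ W_K`,
`#W'(K)[p^∞] = #W(F)[p^∞] · #Wd(F)[p^∞]` for every odd prime `p` (transport of
`card_primaryComponent_point_quadraticTwist_one_baseChange` along `W ≅ W^{(1)}`,
`VariableChange.pointEquiv`). Silverman, *AEC*, Exercises 10.22 (c) / 10.16.
[cite: SilvermanAEC2009, Exercise 10.22 (c) and Exercise 10.16] -/
theorem card_primaryComponent_point_baseChange_quadratic_of_odd'
    {Wd : WeierstrassCurve F} (hWd : ∃ C : VariableChange F, C • W.quadraticTwist c = Wd)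
    {W' : WeierstrassCurve K} (hW' : ∃ C : VariableChange K, C • W.baseChange K = W')
    (p : ℕ) [Fact p.Prime] (hp : p ≠ 2) :
    Nat.card (AddCommGroup.primaryComponent W'.toAffine.Point p) =
      Nat.card (AddCommGroup.primaryComponent W.toAffine.Point p) *
        Nat.card (AddCommGroup.primaryComponent Wd.toAffine.Point p) := by
  obtain ⟨Cd, rfl⟩ := hWd
  obtain ⟨C', rfl⟩ := hW'
  obtain ⟨C, hC⟩ := W.exists_variableChange_quadraticTwist_one
  have hCK : C.map (algebraMap F K) • W.baseChange K = (W.quadraticTwist 1).baseChange K := by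
    rw [baseChange, baseChange, map_variableChange, hC]
  have e1 : W.toAffine.Point ≃+ (W.quadraticTwist 1).toAffine.Point :=
    (VariableChange.pointEquiv W C).trans (Affine.Point.congrEquiv hC)
  have e2 : (C' • W.baseChange K).toAffine.Point ≃+
      ((W.quadraticTwist 1).baseChange K).toAffine.Point :=
    ((VariableChange.pointEquiv (W.baseChange K) C').symm.trans
      (VariableChange.pointEquiv (W.baseChange K) (C.map (algebraMap F K)))).trans
      (Affine.Point.congrEquiv hCK)
  have e3 : (Cd • W.quadraticTwist c).toAffine.Point ≃+ (W.quadraticTwist c).toAffine.Point :=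
    (VariableChange.pointEquiv (W.quadraticTwist c) Cd).symm
  rw [natCard_primaryComponent_congr e1 p, natCard_primaryComponent_congr e2 p,
    natCard_primaryComponent_congr e3 p]
  exact card_primaryComponent_point_quadraticTwist_one_baseChange W h2 hθ hc p hp

include h2 hθ hc in
/-- **`#W'(K)[p^∞] = #W(F)[p^∞] · #Wd(F)[p^∞]` for odd `p`, twist by `d = c q²`.** The same
statement for any `F`-model `Wd` of the twist `W^{(d)}` by an element `d = c q²` of the square
class of `c` (`W^{(c q²)} ≅ W^{(c)}` over `F`, `exists_variableChange_quadraticTwist_mul_sq`).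
Over `F = ℚ` with `K` a quadratic number field this is the shape of the data of
`bsdRHS_baseChange_quadratic`: `K = ℚ(θ)`, `θ² = c` (`Quadratic.exists_sq_eq_algebraMap`) and
`d = d_K = c q²` (`NumberField.exists_discr_eq_mul_sq`), `Wd` any model of `W^{(d_K)}`, `W'` any
`K`-model of `W_K` — the Mordell–Weil companion of
`card_primaryComponent_sha_baseChange_quadratic_of_odd` (instantiate at `F = ℚ`; cf. the design
note of `QuadraticTwistRank` on point groups over `ℚ`). Silverman, *AEC*, Exercises 10.22 (c) / 10.16.
[cite: SilvermanAEC2009, Exercise 10.22 (c) and Exercise 10.16] -/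
theorem card_primaryComponent_point_baseChange_quadratic_of_odd {d q : F} (hq : q ≠ 0)
    (hd : d = c * q ^ 2)
    {Wd : WeierstrassCurve F} (hWd : ∃ C : VariableChange F, C • W.quadraticTwist d = Wd)
    {W' : WeierstrassCurve K} (hW' : ∃ C : VariableChange K, C • W.baseChange K = W')
    (p : ℕ) [Fact p.Prime] (hp : p ≠ 2) :
    Nat.card (AddCommGroup.primaryComponent W'.toAffine.Point p) =
      Nat.card (AddCommGroup.primaryComponent W.toAffine.Point p) *
        Nat.card (AddCommGroup.primaryComponent Wd.toAffine.Point p) := by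
  obtain ⟨C₁, hC₁⟩ := W.exists_variableChange_quadraticTwist_mul_sq c q hq
  rw [← hd] at hC₁
  obtain ⟨Cd, rfl⟩ := hWd
  exact card_primaryComponent_point_baseChange_quadratic_of_odd' W h2 hθ hc
    ⟨Cd * C₁, by rw [mul_smul, hC₁]⟩ hW' p hp

end General

end WeierstrassCurve

/-! ## Part II: the odd part of (R1) in valuations, and what remains -/

open NumberField

namespace Literature.NumberTheory.EllipticCurves

/-! ### Positive rationals are determined by their valuations -/

/-- **Two positive rationals with the same `p`-adic valuation at every prime `p` are equal**
(unique factorisation: `Nat.eq_iff_prime_padicValNat_eq` for `num(x) den(y)` and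
`num(y) den(x)`). [folklore] -/
theorem rat_eq_iff_forall_prime_padicValRat_eq {x y : ℚ} (hx : 0 < x) (hy : 0 < y) :
    x = y ↔ ∀ p : ℕ, p.Prime → padicValRat p x = padicValRat p y := by
  constructor
  · rintro rfl p _
    rfl
  · intro h
    have hxn : 0 < x.num := Rat.num_pos.mpr hx
    have hyn : 0 < y.num := Rat.num_pos.mpr hy
    have hxa : x.num.natAbs ≠ 0 := Int.natAbs_ne_zero.mpr hxn.ne'
    have hya : y.num.natAbs ≠ 0 := Int.natAbs_ne_zero.mpr hyn.ne'
    have key : x.num.natAbs * y.den = y.num.natAbs * x.den := by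
      refine (Nat.eq_iff_prime_padicValNat_eq _ _ (mul_ne_zero hxa y.den_ne_zero)
        (mul_ne_zero hya x.den_ne_zero)).mpr fun p hp => ?_
      haveI := Fact.mk hp
      have hv := h p hp
      rw [padicValRat_def, padicValRat_def, padicValInt, padicValInt] at hv
      rw [padicValNat.mul hxa y.den_ne_zero, padicValNat.mul hya x.den_ne_zero]
      omega
    rw [Rat.eq_iff_mul_eq_mul]
    have key' : ((x.num.natAbs * y.den : ℕ) : ℤ) = ((y.num.natAbs * x.den : ℕ) : ℤ) := by
      exact_mod_cast key
    rwa [Nat.cast_mul, Nat.cast_mul, Int.natCast_natAbs, Int.natCast_natAbs, abs_of_pos hxn,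
      abs_of_pos hyn] at key'

/-! ### `#A[p^∞] = p^{v_p(#A)}` -/

section Primary

variable {A : Type*} [AddCommGroup A] (p : ℕ) [hp : Fact p.Prime]

/-- **The `p`-primary component of a finite abelian group has order `p^{v_p(#A)}`**:
`#A = #A[p^∞] · m` with `p ∤ m` (`exists_natCard_eq_card_primaryComponent_mul`, Lagrange and
Cauchy) and `#A[p^∞]` is a power of `p` (`exists_natCard_primaryComponent_eq_pow`). [folklore] -/
theorem natCard_primaryComponent_eq_pow_padicValNat [Finite A] :
    Nat.card (AddCommGroup.primaryComponent A p) = p ^ padicValNat p (Nat.card A) := by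
  obtain ⟨k, hk⟩ := exists_natCard_primaryComponent_eq_pow (A := A) p
  obtain ⟨m, hm, hpm⟩ := exists_natCard_eq_card_primaryComponent_mul (A := A) p
  have hm0 : m ≠ 0 := by
    rintro rfl
    rw [mul_zero] at hm
    exact (Nat.card_pos (α := A)).ne' hm
  rw [hk] at hm ⊢
  rw [hm, padicValNat.mul (pow_ne_zero _ hp.out.ne_zero) hm0, padicValNat.prime_pow,
    padicValNat.eq_zero_of_not_dvd hpm, add_zero]

/-- If `#C[p^∞] = #A[p^∞] · #B[p^∞]` for finite abelian groups then
`v_p(#C) = v_p(#A) + v_p(#B)`. [folklore] -/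
theorem padicValNat_natCard_eq_add_of_primaryComponent {B C : Type*} [AddCommGroup B]
    [AddCommGroup C] [Finite A] [Finite B] [Finite C]
    (h : Nat.card (AddCommGroup.primaryComponent C p) =
      Nat.card (AddCommGroup.primaryComponent A p) *
        Nat.card (AddCommGroup.primaryComponent B p)) :
    padicValNat p (Nat.card C) = padicValNat p (Nat.card A) + padicValNat p (Nat.card B) := by
  rw [natCard_primaryComponent_eq_pow_padicValNat p, natCard_primaryComponent_eq_pow_padicValNat p,
    natCard_primaryComponent_eq_pow_padicValNat p, ← pow_add] at h
  exact Nat.pow_right_injective hp.out.two_le h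

end Primary

end Literature.NumberTheory.EllipticCurves

namespace WeierstrassCurve

open Literature.NumberTheory.EllipticCurves Literature.NumberTheory.QuadraticFields

/-! ### The odd part of the Mordell–Weil orders -/

section General

variable {F : Type u} {K : Type v} [Field F] [Field K] [Algebra F K] [NeZero (2 : F)]
  (W : WeierstrassCurve F) (h2 : finrank F K = 2) {θ : K} {c : F}
  (hθ : θ ∉ Set.range (algebraMap F K)) (hc : θ ^ 2 = algebraMap F K c)

include h2 hθ hc in
/-- **`v_p(#W'(K)) = v_p(#W(F)) + v_p(#Wd(F))` for odd `p`.** For a field `F` with `2 ≠ 0`,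
`K = F(θ)`, `θ² = c`, an `F`-model `Wd` of the twist `W^{(d)}`, `d = c q²`, and a `K`-model `W'`
of `W_K` with `W'(K)` finite (so `W(F)` and `Wd(F)` are finite), the `p`-adic valuations of the
Mordell–Weil orders add up at every odd prime `p`: `W'(K)[p^∞] ≅ W(F)[p^∞] × Wd(F)[p^∞]`
(`card_primaryComponent_point_baseChange_quadratic_of_odd`) and `#A[p^∞] = p^{v_p(#A)}`.
Silverman, *AEC*, Exercises 10.22 (c) / 10.16, on `p`-primary parts.
[cite: SilvermanAEC2009, Exercise 10.22 (c) and Exercise 10.16] -/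
theorem padicValNat_natCard_point_baseChange_quadratic_of_odd {d q : F} (hq : q ≠ 0)
    (hd : d = c * q ^ 2)
    {Wd : WeierstrassCurve F} (hWd : ∃ C : VariableChange F, C • W.quadraticTwist d = Wd)
    {W' : WeierstrassCurve K} (hW' : ∃ C : VariableChange K, C • W.baseChange K = W')
    [Finite W'.toAffine.Point] (p : ℕ) [Fact p.Prime] (hp : p ≠ 2) :
    padicValNat p (Nat.card W'.toAffine.Point) =
      padicValNat p (Nat.card W.toAffine.Point) + padicValNat p (Nat.card Wd.toAffine.Point) := by
  have hcard := card_primaryComponent_point_baseChange_quadratic_of_odd W h2 hθ hc hq hd hWd hW' p hp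
  obtain ⟨C', rfl⟩ := hW'
  obtain ⟨C₁, hC₁⟩ := W.exists_variableChange_quadraticTwist_mul_sq c q hq
  rw [← hd] at hC₁
  obtain ⟨Cd, rfl⟩ := hWd
  obtain ⟨C, hC⟩ := W.exists_variableChange_quadraticTwist_one
  have hCK : C.map (algebraMap F K) • W.baseChange K = (W.quadraticTwist 1).baseChange K := by
    rw [baseChange, baseChange, map_variableChange, hC]
  -- finiteness of `W(F)` and `Wd(F)`
  haveI : Finite (W.baseChange K).toAffine.Point :=
    Finite.of_equiv _ (VariableChange.pointEquiv (W.baseChange K) C').toEquiv.symm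
  haveI : Finite W.toAffine.Point :=
    Finite.of_injective _ (QuadraticDescent.incl_injective (K := K) W)
  haveI : Finite ((W.quadraticTwist 1).baseChange K).toAffine.Point := by
    rw [← hCK]
    exact Finite.of_equiv _ (VariableChange.pointEquiv (W.baseChange K) _).toEquiv
  haveI : Finite (W.quadraticTwist c).toAffine.Point :=
    Finite.of_injective _ (QuadraticDescent.twistMap_injective W hθ hc)
  haveI : Finite (W.quadraticTwist d).toAffine.Point := by
    rw [← hC₁]
    exact Finite.of_equiv _ (VariableChange.pointEquiv (W.quadraticTwist c) C₁).toEquiv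
  haveI : Finite (Cd • W.quadraticTwist d).toAffine.Point :=
    Finite.of_equiv _ (VariableChange.pointEquiv (W.quadraticTwist d) Cd).toEquiv
  exact padicValNat_natCard_eq_add_of_primaryComponent p hcard

end General

/-! ### Over `ℚ`: finiteness of the `Ш` in sight and the odd part of their orders -/

section Rat

variable (W : WeierstrassCurve ℚ) [W.IsElliptic] (K : Type) [Field K] [NumberField K]

/-- `Ш(W/ℚ)` is finite if `Ш(W'/K)` is, for a `K`-model `W' = C' • W_K`
(`Ш` of `K`-isomorphic curves agree, `shaFinite_variableChange_iff_holds`; `Ш(W/ℚ) → Ш(W_K/K)`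
has finite kernel, `shaFinite_of_baseChange`, Darmon 2004, §3.9). [cite: Darmon2004, §3.9 (proof of Thm. 3.22)] -/
theorem shaFinite_of_shaFinite_smul_baseChange {W' : WeierstrassCurve K} {C' : VariableChange K}
    (hW' : C' • W.baseChange K = W') (h : W'.ShaFinite) : W.ShaFinite := by
  subst hW'
  exact Literature.NumberTheory.EllipticCurves.shaFinite_of_baseChange W K
    ((shaFinite_variableChange_iff_holds (W.baseChange K) C').mp h)

/-- `Ш(Wd/ℚ)` is finite if `Ш(W'/K)` is, for `[K : ℚ] = 2`, a `ℚ`-model `Wd = C_d • W^{(d_K)}` of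
the twist by the discriminant and a `K`-model `W' = C' • W_K`: `K = ℚ(θ)` with `θ² = d_K`
(`Quadratic.exists_sq_eq_algebraMap`, `NumberField.exists_discr_eq_mul_sq`), and
`shaFinite_quadraticTwist_of_shaFinite_baseChange`. [cite: Darmon2004, §3.9 (proof of Thm. 3.22)] -/
theorem shaFinite_twist_of_shaFinite_smul_baseChange (h2 : Module.finrank ℚ K = 2)
    {Wd : WeierstrassCurve ℚ} {Cd : VariableChange ℚ}
    (hWd : Cd • W.quadraticTwist (NumberField.discr K : ℚ) = Wd)
    {W' : WeierstrassCurve K} {C' : VariableChange K} (hW' : C' • W.baseChange K = W')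
    (h : W'.ShaFinite) : Wd.ShaFinite := by
  subst hWd hW'
  obtain ⟨θ, c, hθ, hc⟩ := Quadratic.exists_sq_eq_algebraMap (F := ℚ) (K := K) h2
  obtain ⟨q, hq, hd⟩ := NumberField.exists_discr_eq_mul_sq h2 hθ hc
  -- `θ' = q θ` has `θ'² = d_K` and still generates
  have hθ' : algebraMap ℚ K q * θ ∉ Set.range (algebraMap ℚ K) := by
    rintro ⟨r, hr⟩
    apply hθ
    refine ⟨r / q, ?_⟩
    rw [map_div₀, hr, mul_div_cancel_left₀ _ ((map_ne_zero (algebraMap ℚ K)).mpr hq)]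
  have hc' : (algebraMap ℚ K q * θ) ^ 2 = algebraMap ℚ K (NumberField.discr K : ℚ) := by
    rw [mul_pow, hc, ← map_pow, ← map_mul, hd, mul_comm]
  have hK : (W.baseChange K).ShaFinite :=
    (shaFinite_variableChange_iff_holds (W.baseChange K) C').mp h
  have hD : (W.quadraticTwist (NumberField.discr K : ℚ)).ShaFinite :=
    shaFinite_quadraticTwist_of_shaFinite_baseChange W K hθ' hc' hK
  exact (shaFinite_variableChange_iff_holds (W.quadraticTwist (NumberField.discr K : ℚ)) Cd).mpr hD

/-- **`v_p(#Ш(W')) = v_p(#Ш(W)) + v_p(#Ш(Wd))` for odd `p`** (data of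
`bsdRHS_baseChange_quadratic`: `[K : ℚ] = 2`, `Wd` a `ℚ`-model of `W^{(d_K)}`, `W'` a `K`-model of
`W_K`, with `W'(K)` and `Ш(W'/K)` finite): the odd-primary `Ш`-comparison
`#Ш(W')[p^∞] = #Ш(W)[p^∞] · #Ш(Wd)[p^∞]` (`card_primaryComponent_sha_baseChange_quadratic_of_odd`,
Dokchitser–Dokchitser 2010, Lemma 4.14 at an odd prime) read through `#A[p^∞] = p^{v_p(#A)}` on
the three finite groups `Ш(W')`, `Ш(W)`, `Ш(Wd)`.
[cite: DokchitserDokchitserAnnals2010, Lemma 4.14 (proof) and §2.1 (proof of Thm. 8)] -/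
theorem padicValNat_shaOrder_baseChange_quadratic_of_odd (h2 : Module.finrank ℚ K = 2)
    {Wd : WeierstrassCurve ℚ} [Wd.IsElliptic] {Cd : VariableChange ℚ}
    (hWd : Cd • W.quadraticTwist (NumberField.discr K : ℚ) = Wd)
    {W' : WeierstrassCurve K} [W'.IsElliptic] {C' : VariableChange K}
    (hW' : C' • W.baseChange K = W') [Finite W'.toAffine.Point] (hsha : W'.ShaFinite)
    (p : ℕ) [Fact p.Prime] (hp : p ≠ 2) :
    padicValNat p W'.shaOrder = padicValNat p W.shaOrder + padicValNat p Wd.shaOrder := by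
  haveI : Finite W'.sha := hsha
  haveI : Finite W.sha := W.shaFinite_of_shaFinite_smul_baseChange K hW' hsha
  haveI : Finite Wd.sha := W.shaFinite_twist_of_shaFinite_smul_baseChange K h2 hWd hW' hsha
  exact padicValNat_natCard_eq_add_of_primaryComponent p
    (card_primaryComponent_sha_baseChange_quadratic_of_odd W K h2 Wd ⟨Cd, hWd⟩ W' ⟨C', hW'⟩ p hp)

/-! ### What remains of (R1): its `2`-adic valuation and the odd part of the Tamagawa term -/

/-- **The identity of rationals (R1) equivalent to `bsdRHS_baseChange_quadratic`, split by
primes.** For the data of the named fact (`[K : ℚ] = 2`, `Wd = C_d • W^{(d_K)}`,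
`W' = C' • W_K`, `W'(K)` and `Ш(W'/K)` finite; all three curves elliptic), the identity
`|N_{K/ℚ}(u')| · #Ш(W') · ∏_w c_w(W') · #W(ℚ)² · #Wd(ℚ)²
   = n_W · |u_d| · #Ш(W) · #Ш(Wd) · ∏_p c_p(W) · ∏_p c_p(Wd) · #W'(K)²`
holds if and only if (i) both sides have the same `2`-adic valuation and (ii) for every odd
prime `p`, `v_p(|N_{K/ℚ}(u')| · ∏_w c_w(W')) = v_p(|u_d| · ∏_p c_p(W) · ∏_p c_p(Wd))`.
Indeed both sides are positive, a positive rational is determined by its valuations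
(`rat_eq_iff_forall_prime_padicValRat_eq`), `n_W ∈ {1, 2}` is a unit at odd `p`
(`numRealComponents_baseChange_real`), and at odd `p` the `Ш`- and Mordell–Weil orders balance
(`padicValNat_shaOrder_baseChange_quadratic_of_odd`,
`padicValNat_natCard_point_baseChange_quadratic_of_odd`). In Milne's proof (ii) and (i) come
from the local indices of `E × E^{(D)} → Res_{K/ℚ} E_K` and global duality (module docstring).
[cite: Milne1972ArithmeticAV, §1 Thm. 1 and §2 (through DokchitserDokchitserAnnals2010, §2.1, proof of Thm. 8)] -/
theorem card_identity_iff_padicValRat (h2 : Module.finrank ℚ K = 2)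
    {Wd : WeierstrassCurve ℚ} [Wd.IsElliptic] {Cd : VariableChange ℚ}
    (hWd : Cd • W.quadraticTwist (NumberField.discr K : ℚ) = Wd)
    {W' : WeierstrassCurve K} [W'.IsElliptic] {C' : VariableChange K}
    (hW' : C' • W.baseChange K = W') [Finite W'.toAffine.Point] (hsha : W'.ShaFinite) :
    (|Algebra.norm ℚ (C'.u : K)| * W'.shaOrder * W'.tamagawaProduct *
          (Nat.card W.toAffine.Point) ^ 2 * (Nat.card Wd.toAffine.Point) ^ 2 : ℚ) =
        (W.baseChange ℝ).numRealComponents * |(Cd.u : ℚ)| * W.shaOrder * Wd.shaOrder *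
          W.tamagawaProduct * Wd.tamagawaProduct * (Nat.card W'.toAffine.Point) ^ 2 ↔
      padicValRat 2 (|Algebra.norm ℚ (C'.u : K)| * W'.shaOrder * W'.tamagawaProduct *
            (Nat.card W.toAffine.Point) ^ 2 * (Nat.card Wd.toAffine.Point) ^ 2 : ℚ) =
          padicValRat 2 ((W.baseChange ℝ).numRealComponents * |(Cd.u : ℚ)| * W.shaOrder *
            Wd.shaOrder * W.tamagawaProduct * Wd.tamagawaProduct *
            (Nat.card W'.toAffine.Point) ^ 2 : ℚ) ∧
        ∀ p : ℕ, p.Prime → p ≠ 2 →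
          padicValRat p (|Algebra.norm ℚ (C'.u : K)| * W'.tamagawaProduct : ℚ) =
            padicValRat p (|(Cd.u : ℚ)| * (W.tamagawaProduct * Wd.tamagawaProduct) : ℚ) := by
  -- finiteness and the nonvanishing of all factors
  haveI hfinQ : Finite W.toAffine.Point := finite_point_of_finite_point_smul_baseChange W K hW'
  haveI hfinD : Finite Wd.toAffine.Point :=
    finite_point_twist_of_finite_point_smul_baseChange W K h2 hWd hW'
  have hshaQ : W.ShaFinite := W.shaFinite_of_shaFinite_smul_baseChange K hW' hsha
  have hshaD : Wd.ShaFinite := W.shaFinite_twist_of_shaFinite_smul_baseChange K h2 hWd hW' hsha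
  have hnorm : Algebra.norm ℚ (C'.u : K) ≠ 0 := Algebra.norm_ne_zero_iff.mpr (C'.u).ne_zero
  have hud : (Cd.u : ℚ) ≠ 0 := (Cd.u).ne_zero
  have hS'0 : 0 < W'.shaOrder := W'.shaOrder_pos hsha
  have hS0 : 0 < W.shaOrder := W.shaOrder_pos hshaQ
  have hSd0 : 0 < Wd.shaOrder := Wd.shaOrder_pos hshaD
  have hT'0 : 0 < W'.tamagawaProduct := W'.tamagawaProduct_pos'
  have hT0 : 0 < W.tamagawaProduct := W.tamagawaProduct_pos'
  have hTd0 : 0 < Wd.tamagawaProduct := Wd.tamagawaProduct_pos'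
  have hN'0 : 0 < Nat.card W'.toAffine.Point := Nat.card_pos
  have hN0 : 0 < Nat.card W.toAffine.Point := Nat.card_pos
  have hNd0 : 0 < Nat.card Wd.toAffine.Point := Nat.card_pos
  have hn0 : 0 < (W.baseChange ℝ).numRealComponents := (W.baseChange ℝ).numRealComponents_pos
  have ha : (|Algebra.norm ℚ (C'.u : K)| : ℚ) ≠ 0 := abs_ne_zero.mpr hnorm
  have hb : (|(Cd.u : ℚ)| : ℚ) ≠ 0 := abs_ne_zero.mpr hud
  have hS' : (W'.shaOrder : ℚ) ≠ 0 := by exact_mod_cast hS'0.ne'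
  have hS : (W.shaOrder : ℚ) ≠ 0 := by exact_mod_cast hS0.ne'
  have hSd : (Wd.shaOrder : ℚ) ≠ 0 := by exact_mod_cast hSd0.ne'
  have hT' : (W'.tamagawaProduct : ℚ) ≠ 0 := by exact_mod_cast hT'0.ne'
  have hT : (W.tamagawaProduct : ℚ) ≠ 0 := by exact_mod_cast hT0.ne'
  have hTd : (Wd.tamagawaProduct : ℚ) ≠ 0 := by exact_mod_cast hTd0.ne'
  have hN' : (Nat.card W'.toAffine.Point : ℚ) ≠ 0 := by exact_mod_cast hN'0.ne'
  have hN : (Nat.card W.toAffine.Point : ℚ) ≠ 0 := by exact_mod_cast hN0.ne'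
  have hNd : (Nat.card Wd.toAffine.Point : ℚ) ≠ 0 := by exact_mod_cast hNd0.ne'
  have hn : ((W.baseChange ℝ).numRealComponents : ℚ) ≠ 0 := by exact_mod_cast hn0.ne'
  -- positivity of both sides
  have hxpos : (0 : ℚ) < |Algebra.norm ℚ (C'.u : K)| * W'.shaOrder * W'.tamagawaProduct *
      (Nat.card W.toAffine.Point) ^ 2 * (Nat.card Wd.toAffine.Point) ^ 2 := by
    positivity
  have hypos : (0 : ℚ) < (W.baseChange ℝ).numRealComponents * |(Cd.u : ℚ)| * W.shaOrder *
      Wd.shaOrder * W.tamagawaProduct * Wd.tamagawaProduct * (Nat.card W'.toAffine.Point) ^ 2 := by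
    positivity
  -- the odd part: valuations of both sides at an odd prime
  have hodd : ∀ p : ℕ, p.Prime → p ≠ 2 →
      (padicValRat p (|Algebra.norm ℚ (C'.u : K)| * W'.shaOrder * W'.tamagawaProduct *
            (Nat.card W.toAffine.Point) ^ 2 * (Nat.card Wd.toAffine.Point) ^ 2 : ℚ) =
          padicValRat p ((W.baseChange ℝ).numRealComponents * |(Cd.u : ℚ)| * W.shaOrder *
            Wd.shaOrder * W.tamagawaProduct * Wd.tamagawaProduct *
            (Nat.card W'.toAffine.Point) ^ 2 : ℚ) ↔
        padicValRat p (|Algebra.norm ℚ (C'.u : K)| * W'.tamagawaProduct : ℚ) =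
          padicValRat p (|(Cd.u : ℚ)| * (W.tamagawaProduct * Wd.tamagawaProduct) : ℚ)) := by
    intro p hp hp2
    haveI := Fact.mk hp
    -- the `Ш`- and Mordell–Weil orders balance at `p`
    obtain ⟨θ, c, hθ, hc⟩ := Quadratic.exists_sq_eq_algebraMap (F := ℚ) (K := K) h2
    obtain ⟨q, hq, hd⟩ := NumberField.exists_discr_eq_mul_sq h2 hθ hc
    have hMW : (padicValNat p (Nat.card W'.toAffine.Point) : ℤ) =
        padicValNat p (Nat.card W.toAffine.Point) + padicValNat p (Nat.card Wd.toAffine.Point) := by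
      exact_mod_cast W.padicValNat_natCard_point_baseChange_quadratic_of_odd h2 hθ hc hq hd
        ⟨Cd, hWd⟩ ⟨C', hW'⟩ p hp2
    have hSha : (padicValNat p W'.shaOrder : ℤ) =
        padicValNat p W.shaOrder + padicValNat p Wd.shaOrder := by
      exact_mod_cast W.padicValNat_shaOrder_baseChange_quadratic_of_odd K h2 hWd hW' hsha p hp2
    -- `n_W ∈ {1, 2}` is a `p`-adic unit
    have hnv : padicValRat p ((W.baseChange ℝ).numRealComponents : ℚ) = 0 := by
      rw [numRealComponents_baseChange_real]
      split_ifs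
      · haveI : Fact (Nat.Prime 2) := ⟨Nat.prime_two⟩
        rw [padicValRat.of_nat, padicValNat_primes hp2, Nat.cast_zero]
      · rw [Nat.cast_one, padicValRat.one]
    -- expand the valuations of the two products
    rw [padicValRat.mul (mul_ne_zero (mul_ne_zero (mul_ne_zero ha hS') hT') (pow_ne_zero 2 hN))
        (pow_ne_zero 2 hNd),
      padicValRat.mul (mul_ne_zero (mul_ne_zero ha hS') hT') (pow_ne_zero 2 hN),
      padicValRat.mul (mul_ne_zero ha hS') hT', padicValRat.mul ha hS',
      padicValRat.mul (mul_ne_zero (mul_ne_zero (mul_ne_zero (mul_ne_zero (mul_ne_zero hn hb) hS)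
        hSd) hT) hTd) (pow_ne_zero 2 hN'),
      padicValRat.mul (mul_ne_zero (mul_ne_zero (mul_ne_zero (mul_ne_zero hn hb) hS) hSd) hT) hTd,
      padicValRat.mul (mul_ne_zero (mul_ne_zero (mul_ne_zero hn hb) hS) hSd) hT,
      padicValRat.mul (mul_ne_zero (mul_ne_zero hn hb) hS) hSd,
      padicValRat.mul (mul_ne_zero hn hb) hS, padicValRat.mul hn hb,
      padicValRat.mul ha hT', padicValRat.mul hb (mul_ne_zero hT hTd), padicValRat.mul hT hTd,
      padicValRat.pow, padicValRat.pow, padicValRat.pow, hnv,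
      padicValRat.of_nat, padicValRat.of_nat, padicValRat.of_nat, padicValRat.of_nat,
      padicValRat.of_nat, padicValRat.of_nat, padicValRat.of_nat, padicValRat.of_nat,
      padicValRat.of_nat]
    constructor
    · intro h
      linear_combination h - hSha + 2 * hMW
    · intro h
      linear_combination h + hSha - 2 * hMW
  -- assemble
  rw [rat_eq_iff_forall_prime_padicValRat_eq hxpos hypos]
  constructor
  · intro h
    exact ⟨h 2 Nat.prime_two, fun p hp hp2 => (hodd p hp hp2).mp (h p hp)⟩
  · rintro ⟨htwo, hodd'⟩ p hp
    by_cases hp2 : p = 2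
    · subst hp2
      exact htwo
    · exact (hodd p hp hp2).mpr (hodd' p hp hp2)

end Rat

/-! ### The named fact from the `2`-adic identity and the odd Tamagawa identity -/

/-- **`bsdRHS_baseChange_quadratic` from its `2`-adic part and the odd part of the Tamagawa
term.** If for all data of the named fact (globally minimal elliptic `W/ℚ`, imaginary quadratic
`K`, globally minimal `Wd = C_d • W^{(d_K)}` and `W' = C' • W_K`, `W'(K)` and `Ш(W'/K)` finite)
(i) the two sides of (R1) have the same `2`-adic valuation and (ii) for every odd prime `p`,
`v_p(|N_{K/ℚ}(u')| · ∏_w c_w(W')) = v_p(|u_d| · ∏_p c_p(W) · ∏_p c_p(Wd))`, then the BSD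
quotient of `E_K/K` is the product of those of `E/ℚ` and `E^{(d_K)}/ℚ` (Milne 1972, Thm. 1;
Dokchitser–Dokchitser 2010, proof of Thm. 8), by `card_identity_iff_padicValRat` and
`bsdRHS_baseChange_quadratic_of_card_identity`.
[cite: Milne1972ArithmeticAV, §1 Thm. 1 and §2 (through DokchitserDokchitserAnnals2010, §2.1, proof of Thm. 8)] -/
theorem bsdRHS_baseChange_quadratic_of_padicValRat
    (htwo : ∀ (W : WeierstrassCurve ℚ) [W.IsElliptic] [W.IsGloballyMinimal]
      (K : Type) [Field K] [NumberField K] [IsTotallyComplex K], Module.finrank ℚ K = 2 →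
      ∀ (Wd : WeierstrassCurve ℚ) [Wd.IsElliptic] [Wd.IsGloballyMinimal] (Cd : VariableChange ℚ),
        Cd • W.quadraticTwist (NumberField.discr K : ℚ) = Wd →
      ∀ (W' : WeierstrassCurve K) [W'.IsElliptic] [W'.IsGloballyMinimal] (C' : VariableChange K),
        C' • W.baseChange K = W' → Finite W'.toAffine.Point → W'.ShaFinite →
        padicValRat 2 (|Algebra.norm ℚ (C'.u : K)| * W'.shaOrder * W'.tamagawaProduct *
              (Nat.card W.toAffine.Point) ^ 2 * (Nat.card Wd.toAffine.Point) ^ 2 : ℚ) =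
          padicValRat 2 ((W.baseChange ℝ).numRealComponents * |(Cd.u : ℚ)| * W.shaOrder *
            Wd.shaOrder * W.tamagawaProduct * Wd.tamagawaProduct *
            (Nat.card W'.toAffine.Point) ^ 2 : ℚ))
    (hodd : ∀ (W : WeierstrassCurve ℚ) [W.IsElliptic] [W.IsGloballyMinimal]
      (K : Type) [Field K] [NumberField K] [IsTotallyComplex K], Module.finrank ℚ K = 2 →
      ∀ (Wd : WeierstrassCurve ℚ) [Wd.IsElliptic] [Wd.IsGloballyMinimal] (Cd : VariableChange ℚ),
        Cd • W.quadraticTwist (NumberField.discr K : ℚ) = Wd →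
      ∀ (W' : WeierstrassCurve K) [W'.IsElliptic] [W'.IsGloballyMinimal] (C' : VariableChange K),
        C' • W.baseChange K = W' → Finite W'.toAffine.Point → W'.ShaFinite →
        ∀ p : ℕ, p.Prime → p ≠ 2 →
          padicValRat p (|Algebra.norm ℚ (C'.u : K)| * W'.tamagawaProduct : ℚ) =
            padicValRat p (|(Cd.u : ℚ)| * (W.tamagawaProduct * Wd.tamagawaProduct) : ℚ)) :
    bsdRHS_baseChange_quadratic := by
  refine bsdRHS_baseChange_quadratic_of_card_identity
    fun W _ _ K _ _ _ h2 Wd _ _ Cd hWd W' _ _ C' hW' hfin hsha => ?_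
  haveI := hfin
  exact (W.card_identity_iff_padicValRat K h2 hWd hW' hsha).mpr
    ⟨htwo W K h2 Wd Cd hWd W' C' hW' hfin hsha, hodd W K h2 Wd Cd hWd W' C' hW' hfin hsha⟩

end WeierstrassCurve

end
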